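import Literature.FieldTheory.Separability.PIndependentDerivations
import Mathlib.RingTheory.LocalRing.ResidueField.Basic
import Mathlib.RingTheory.Derivation.Basic
import Mathlib.LinearAlgebra.Quotient.Basic
import HarnessLib

/-!
# Crux `Steer` (stmt-ResolutionOfSingularities-16345), chain W4.1, hA3 Θ1♭ piece (L7), brick **(L7-Ω)**, supplement:
# an `𝔪`-logarithmic derivation DESCENDS to the residue field, and is determined there by a `p`-basis

OURS (campaign `res-hironaka`, rung L ★L-G4, slot W4.1; seat res-L0-w41-stub-4 g6 for res-D-pv-004 (AS res-L0-w41-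
stub-10)'s (L7) plan, step (c) «the continuous extension of `∂_{u_j}` is the coefficientwise `D̃_{δ_j}`»; replaces
the role of no printed item; NOT a statement of the manuscript under review [claim: Hironaka2017, status: under-review];
AI-produced, weaker than expert review). Theses-free and definition-free; independent of parts 1–3
(`FrobeniusClosingSteerMemberDerivationFrame{Engine,Basis,}.lean`) and consumed next to `MemberDerivationFrame.exists_frame`.

* `exists_residueField_derivation` — an `R`-derivation `D ∈ Der_R(S)` of a local `R`-algebra with `D 𝔪 ⊆ 𝔪` induces
  `D̄ ∈ Der_R(κ)`, `κ = S/𝔪`, with `D̄ (s̄) = (D s)‾` (descent through `S ↠ κ`).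
* `residue_apply_eq_of_apply_eq` — if moreover `char κ = p`, `κ = κ^p(ū)` and `(D u_j)‾ = δ (ū_j)` for a derivation
  `δ ∈ Der_R(κ)`, then `(D s)‾ = δ (s̄)` for ALL `s ∈ S` (two derivations of `κ` agreeing on `κ^p ∪ {ū_j}` agree:
  tree `Derivation.eqOn_subfieldClosure`).
* `residue_frame_apply_eq` — in the 𝔪-adapted frame of `MemberDerivationFrame.exists_frame` (`du_j (x_i) = 0`,
  `du_j (u_{j'}) = δ_{jj'}`, `δ_j (ū_{j'}) = δ_{jj'}`, `κ = κ^p(ū)`): **`(du_j s)‾ = δ_j (s̄)`** — the `u`-directions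
  REDUCE to the dual derivations of the residue `p`-basis.

[cite: Matsumura1987, §26 p. 202 and Thm. 26.5; §30 Thm. 30.6] [folklore]
bears_on: LADDER-RESOLUTION L ★L-G4 W4.1 (crux `Steer`, hA3 (L7)).
-/

noncomputable section

-- `Summit.<S>.<S>.…` duplicates the summit name by design (single-problem summit).
set_option linter.dupNamespace false

open IsLocalRing

namespace Summit.ResolutionOfSingularities.ResolutionOfSingularities.Theorems.SwitchingDichotomy.MemberDerivationFrame

open Literature.FieldTheory.Separability

universe u v w

/-- **Descent of an `𝔪`-logarithmic derivation to the residue field**: for a local `R`-algebra `S` and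
`D ∈ Der_R(S)` with `D 𝔪 ⊆ 𝔪` there is `D̄ ∈ Der_R(κ)`, `κ = S/𝔪`, with `D̄ (s̄) = (D s)‾`. [folklore] -/
theorem exists_residueField_derivation {R : Type v} {S : Type u} [CommRing R] [CommRing S] [IsLocalRing S]
    [Algebra R S] (D : Derivation R S S) (hD : ∀ a ∈ maximalIdeal S, D a ∈ maximalIdeal S) :
    ∃ Dbar : Derivation R (ResidueField S) (ResidueField S), ∀ s, Dbar (residue S s) = residue S (D s) := by
  let L : S →ₗ[R] ResidueField S :=
    ((Algebra.linearMap S (ResidueField S)).restrictScalars R) ∘ₗ D.toLinearMap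
  have hL : ∀ s, L s = residue S (D s) := fun _ => rfl
  have hker : (maximalIdeal S).restrictScalars R ≤ LinearMap.ker L := by
    intro a ha
    rw [LinearMap.mem_ker, hL, residue_eq_zero_iff]
    exact hD a ha
  let Lq : (S ⧸ (maximalIdeal S).restrictScalars R) →ₗ[R] ResidueField S :=
    ((maximalIdeal S).restrictScalars R).liftQ L hker
  let e : (S ⧸ maximalIdeal S) ≃ₗ[R] S ⧸ (maximalIdeal S).restrictScalars R :=
    (Submodule.Quotient.restrictScalarsEquiv R (maximalIdeal S)).symm
  let Lbar : ResidueField S →ₗ[R] ResidueField S := Lq ∘ₗ e.toLinearMap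
  have hLbar : ∀ s, Lbar (residue S s) = residue S (D s) := by
    intro s
    change Lq (e (Submodule.Quotient.mk s)) = _
    rw [Submodule.Quotient.restrictScalarsEquiv_symm_mk, Submodule.liftQ_apply]
    exact hL s
  refine ⟨Derivation.mk' Lbar fun a b => ?_, fun s => by rw [Derivation.coe_mk', hLbar]⟩
  obtain ⟨a, rfl⟩ := residue_surjective a
  obtain ⟨b, rfl⟩ := residue_surjective b
  rw [← map_mul, hLbar, hLbar, hLbar, D.leibniz, smul_eq_mul, smul_eq_mul, map_add, map_mul, map_mul,
    smul_eq_mul, smul_eq_mul]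

/-- **An `𝔪`-logarithmic derivation is determined on the residue field by a `p`-basis**: `S` a local `R`-algebra with
residue field `κ` of characteristic `p`, `D ∈ Der_R(S)` with `D 𝔪 ⊆ 𝔪`, `δ ∈ Der_R(κ)`, `u : ι → S` with
`κ = κ^p(ū)` (the subfield generated by the `p`-th powers and the `ū_j` is `κ`) and `(D u_j)‾ = δ (ū_j)` for all
`j`. Then `(D s)‾ = δ (s̄)` for every `s ∈ S`. [cite: Matsumura1987, §26 p. 202] [folklore] -/
theorem residue_apply_eq_of_apply_eq (p : ℕ) {R : Type v} {S : Type u} [CommRing R] [CommRing S] [IsLocalRing S]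
    [Algebra R S] [CharP (ResidueField S) p] (D : Derivation R S S)
    (hD : ∀ a ∈ maximalIdeal S, D a ∈ maximalIdeal S) (δ : Derivation R (ResidueField S) (ResidueField S))
    {ι : Type w} (u : ι → S)
    (hu : Subfield.closure (Set.range (fun y : ResidueField S => y ^ p) ∪
      Set.range (fun j => residue S (u j))) = ⊤)
    (hagree : ∀ j, residue S (D (u j)) = δ (residue S (u j))) (s : S) :
    residue S (D s) = δ (residue S s) := by
  obtain ⟨Dbar, hDbar⟩ := exists_residueField_derivation D hD
  rw [← hDbar]
  -- derivations of `κ` kill `p`-th powers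
  have hpow : ∀ (D' : Derivation ℤ (ResidueField S) (ResidueField S)) (y : ResidueField S), D' (y ^ p) = 0 :=
    fun D' y => by
      rw [Derivation.leibniz_pow, ← Nat.cast_smul_eq_nsmul (ResidueField S), CharP.cast_eq_zero, zero_smul]
  have heq : Set.EqOn (Dbar.restrictScalars ℤ) (δ.restrictScalars ℤ)
      (Set.range (fun y : ResidueField S => y ^ p) ∪ Set.range (fun j => residue S (u j))) := by
    rintro _ (⟨y, rfl⟩ | ⟨j, rfl⟩)
    · change Dbar.restrictScalars ℤ (y ^ p) = δ.restrictScalars ℤ (y ^ p)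
      rw [hpow, hpow]
    · change Dbar (residue S (u j)) = δ (residue S (u j))
      rw [hDbar, hagree]
  exact Derivation.eqOn_subfieldClosure heq (x := residue S s) (by rw [hu]; trivial)

/-- **In the 𝔪-adapted frame the `u`-directions reduce to the residue duals**: `S` a local `k`-algebra with residue
field `κ` of characteristic `p`, `(x) = 𝔪`, `u : Fin e → S` with `κ = κ^p(ū)`, `δ_j ∈ Der_k(κ)` dual to `ū`
(`δ_j (ū_{j'}) = δ_{jj'}`), and `du_j ∈ Der_k(S)` with `du_j (x_i) = 0`, `du_j (u_{j'}) = δ_{jj'}` (the output of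
`MemberDerivationFrame.exists_frame`). Then `(du_j s)‾ = δ_j (s̄)` for all `s ∈ S`. [cite: Matsumura1987, Thm. 30.6]
[folklore] -/
theorem residue_frame_apply_eq (p : ℕ) {k S : Type u} [Field k] [CommRing S] [IsLocalRing S] [Algebra k S]
    [CharP (ResidueField S) p] {c e : ℕ} (x : Fin c → S) (hx : Ideal.span (Set.range x) = maximalIdeal S)
    (u : Fin e → S)
    (hu : Subfield.closure (Set.range (fun y : ResidueField S => y ^ p) ∪
      Set.range (fun j => residue S (u j))) = ⊤)
    (δ : Fin e → Derivation k (ResidueField S) (ResidueField S))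
    (hδ : ∀ j j', δ j (residue S (u j')) = if j' = j then 1 else 0)
    (du : Fin e → Derivation k S S) (hdux : ∀ j i, du j (x i) = 0)
    (hduu : ∀ j j', du j (u j') = if j' = j then 1 else 0) (j : Fin e) (s : S) :
    residue S (du j s) = δ j (residue S s) := by
  -- `du j` is `𝔪`-logarithmic since it kills the generators `x i`
  have hlog : ∀ a ∈ maximalIdeal S, du j a ∈ maximalIdeal S := by
    intro a ha
    rw [← hx] at ha ⊢
    refine Submodule.span_induction ?_ ?_ ?_ ?_ ha
    · rintro _ ⟨i, rfl⟩
      rw [hdux]; exact zero_mem _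
    · rw [map_zero]; exact zero_mem _
    · intro a b _ _ ha hb
      rw [map_add]; exact add_mem ha hb
    · intro r a ha' hDa
      rw [smul_eq_mul, Derivation.leibniz, smul_eq_mul, smul_eq_mul]
      exact add_mem (Ideal.mul_mem_left _ _ hDa) (Ideal.mul_mem_right _ _ ha')
  refine residue_apply_eq_of_apply_eq p (du j) hlog (δ j) u hu (fun j' => ?_) s
  rw [hduu, hδ]
  split_ifs
  · exact map_one _
  · exact map_zero _

end Summit.ResolutionOfSingularities.ResolutionOfSingularities.Theorems.SwitchingDichotomy.MemberDerivationFrame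

end
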